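import Summits.CriticalPhenomena.PercolationContinuityZ3.Theorems.Transplant.TriFilmRouteX2
import HarnessLib

/-!
# Routing in the triangular films — the exceptional configurations, equal heights, and the assembly of all sixteen

builds on p205010 (kernel theorem, internal audit signed; external expert review pending) — NOT used in this file.  Lane `prim-bschramm`, seat
`prim-bschramm-p2` (gen 33; class C1b; memo `HOME/bschramm/P2-LATTICES.md` §121); helper file (`--supports stmt-CriticalPhenomena-4575 --as helper`).
* `exists_swap_pair_X2_eq`: type 2 (`E₁ = (B,h)`, `E₂ = (A,h)`, `w' = (C,h₃)`) through an adjacent layer `h'` (towards `h₃` when `h₃ ≠ h`);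
* **`TriFilm.exists_swap_pair_exceptional`**: swap pairs for all sixteen exceptional configurations of «TriClawTable», all heights, `k ≥ 2`.
[cite: DuminilCopinSidoraviciusTassion2016, §2.3 (proof of Fact 2)]
-/

noncomputable section

namespace Summit.CriticalPhenomena.PercolationContinuityZ3.Theorems.Transplant

open Literature.Probability.Percolation Literature.Probability.LatticeModels SimpleGraph
open scoped Classical

namespace TriFilm

open TriClaw

variable {k : ℕ}

section Routes

variable (hk : 2 ≤ k) {RP D : Set (Site 2)} (hRP : ∀ w : Pt, tn w ≤ 3 → w.1 ≤ 0 → toSite w ∈ RP) (hD : ∀ w : Pt, tn w ≤ 3 → w.1 ≤ 0 → toSite w ∈ D)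
include hk hRP hD

/-- **Type 2, equal heights `h₁ = h₂ = h`.** [cite: DuminilCopinSidoraviciusTassion2016, §2.3 (proof of Fact 2)] -/
theorem exists_swap_pair_X2_eq (m : Bool) {h h₃ : ℕ} (hh : h ≤ k) (hh₃ : h₃ ≤ k) :
    ∃ r₁ r₂ : (hexShadow k).RouteData RP D (vx k (toSite (XB m)) h) (vx k (toSite (XA m)) h) (vx k (toSite (XC m)) h₃), r₁.y = r₂.b ∧ r₁.b = r₂.y := by
  obtain ⟨hAB, hAC, hBC, hCD, hDB, -, -, -, -, hHC⟩ := X_adj m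
  have hmemA : XA m ∈ [XA m, XB m, XC m, XD m, XE m, XF m, XG m, XH m] := by simp
  have hmemB : XB m ∈ [XA m, XB m, XC m, XD m, XE m, XF m, XG m, XH m] := by simp
  have hmemC : XC m ∈ [XA m, XB m, XC m, XD m, XE m, XF m, XG m, XH m] := by simp
  have hmemD : XD m ∈ [XA m, XB m, XC m, XD m, XE m, XF m, XG m, XH m] := by simp
  have hmemH : XH m ∈ [XA m, XB m, XC m, XD m, XE m, XF m, XG m, XH m] := by simp
  have dAB : toSite (XA m) ≠ toSite (XB m) := fun h => by have := toSite_injective h; revert this; cases m <;> decide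
  have dAC : toSite (XA m) ≠ toSite (XC m) := fun h => by have := toSite_injective h; revert this; cases m <;> decide
  have dAD : toSite (XA m) ≠ toSite (XD m) := fun h => by have := toSite_injective h; revert this; cases m <;> decide
  have dBC : toSite (XB m) ≠ toSite (XC m) := fun h => by have := toSite_injective h; revert this; cases m <;> decide
  have dBD : toSite (XB m) ≠ toSite (XD m) := fun h => by have := toSite_injective h; revert this; cases m <;> decide
  have dCD : toSite (XC m) ≠ toSite (XD m) := fun h => by have := toSite_injective h; revert this; cases m <;> decide
  have dAH : toSite (XA m) ≠ toSite (XH m) := fun h => by have := toSite_injective h; revert this; cases m <;> decide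
  have dBH : toSite (XB m) ≠ toSite (XH m) := fun h => by have := toSite_injective h; revert this; cases m <;> decide
  have dDH : toSite (XD m) ≠ toSite (XH m) := fun h => by have := toSite_injective h; revert this; cases m <;> decide
  have hE : vx k (toSite (XB m)) h ≠ vx k (toSite (XA m)) h := fun e => dAB ((vx_inj hh hh).1 e).1.symm
  obtain ⟨hh'k, hadj, hfar⟩ := adjLayer_spec hk hh hh₃
  set h' := adjLayer k h h₃ with hh'
  have hne' : h' ≠ h := by omega
  have vB : (film k).Adj (vx k (toSite (XB m)) h) (vx k (toSite (XB m)) h') := (adj_vx_iff hh hh'k).2 (Or.inr ⟨rfl, hadj⟩)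
  have vA : (film k).Adj (vx k (toSite (XA m)) h') (vx k (toSite (XA m)) h) := (adj_vx_iff hh'k hh).2 (Or.inr ⟨rfl, hadj.symm⟩)
  have vD : (film k).Adj (vx k (toSite (XD m)) h) (vx k (toSite (XD m)) h') := (adj_vx_iff hh hh'k).2 (Or.inr ⟨rfl, hadj⟩)
  have vH : (film k).Adj (vx k (toSite (XH m)) h') (vx k (toSite (XH m)) h) := (adj_vx_iff hh'k hh).2 (Or.inr ⟨rfl, hadj.symm⟩)
  -- Route 1: `L = (B,h)(B,h')(A,h')(A,h)`, `c :: Br = (B,h)(D',h)(C,h) · column C`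
  have SL : FPath k [vx k (toSite (XB m)) h, vx k (toSite (XB m)) h', vx k (toSite (XA m)) h', vx k (toSite (XA m)) h] (vx k (toSite (XB m)) h)
      (vx k (toSite (XA m)) h) :=
    fpath_four vB (adj_vx_planar hAB.symm hh'k) vA (fun e => dAB ((vx_inj hh hh'k).1 e).1.symm) hE (fun e => dAB ((vx_inj hh'k hh).1 e).1.symm)
  have Q1 : FPath k [vx k (toSite (XB m)) h, vx k (toSite (XD m)) h, vx k (toSite (XC m)) h] (vx k (toSite (XB m)) h) (vx k (toSite (XC m)) h) :=
    fpath_three (adj_vx_planar hDB.symm hh) (adj_vx_planar hCD.symm hh) (fun e => dBC ((vx_inj hh hh).1 e).1)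
  have Q2 : FPath k (vseg k (toSite (XC m)) h h₃) (vx k (toSite (XC m)) h) (vx k (toSite (XC m)) h₃) := fpath_vseg _ hh hh₃
  have RC : FPath k ([vx k (toSite (XB m)) h, vx k (toSite (XD m)) h, vx k (toSite (XC m)) h] ++ (vseg k (toSite (XC m)) h h₃).tail)
      (vx k (toSite (XB m)) h) (vx k (toSite (XC m)) h₃) := by
    refine Q1.trans Q2 fun v hv hv1 => ?_
    simp only [List.mem_cons, List.not_mem_nil, or_false] at hv1
    rcases hv1 with rfl | rfl | rfl
    · exact absurd (fst_of_mem_vseg hv) dBC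
    · exact absurd (fst_of_mem_vseg hv) dCD.symm
    · rfl
  set CB := [vx k (toSite (XB m)) h, vx k (toSite (XD m)) h, vx k (toSite (XC m)) h] ++ (vseg k (toSite (XC m)) h h₃).tail with hCB
  have mCBt : ∀ v ∈ CB.tail, v = vx k (toSite (XD m)) h ∨ v ∈ vseg k (toSite (XC m)) h h₃ := by
    intro v hv
    simp only [hCB, List.cons_append, List.tail_cons, List.mem_cons] at hv
    rcases hv with rfl | rfl | hv
    · exact Or.inl rfl
    · exact Or.inr Q2.head_mem
    · exact Or.inr (List.mem_of_mem_tail hv)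
  set L := [vx k (toSite (XB m)) h, vx k (toSite (XB m)) h', vx k (toSite (XA m)) h', vx k (toSite (XA m)) h] with hL
  have mL : ∀ v ∈ L, ((v : triFilm k) : Site 2 × Site 1).1 = toSite (XB m) ∨ ((v : triFilm k) : Site 2 × Site 1).1 = toSite (XA m) := by
    intro v hv; simp only [hL, List.mem_cons, List.not_mem_nil, or_false] at hv
    rcases hv with rfl | rfl | rfl | rfl <;> simp
  have hLRP : ∀ v ∈ L, ((v : triFilm k) : Site 2 × Site 1).1 ∈ RP := by
    intro v hv; rcases mL v hv with h | h <;> rw [h]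
    · exact X_RP hRP m hmemB
    · exact X_RP hRP m hmemA
  have r₁ : ∃ r : (hexShadow k).RouteData RP D (vx k (toSite (XB m)) h) (vx k (toSite (XA m)) h) (vx k (toSite (XC m)) h₃),
      r.y = vx k (toSite (XB m)) h' ∧ r.b = vx k (toSite (XD m)) h := by
    have hsplit : L = [] ++ vx k (toSite (XB m)) h :: vx k (toSite (XB m)) h' :: [vx k (toSite (XA m)) h', vx k (toSite (XA m)) h] := by simp [hL]
    have hCBne : CB.tail ≠ [] := by simp [hCB]
    have hCBeq : CB = vx k (toSite (XB m)) h :: vx k (toSite (XD m)) h :: (vx k (toSite (XC m)) h :: (vseg k (toSite (XC m)) h h₃).tail) := by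
      simp [hCB]
    have hCBD : ∀ v ∈ CB.tail, ((v : triFilm k) : Site 2 × Site 1).1 ∈ D := by
      intro v hv; rcases mCBt v hv with e | e
      · rw [e]; exact X_D hD m hmemD
      · rw [fst_of_mem_vseg e]; exact X_D hD m hmemC
    have hdisj : ∀ v ∈ CB.tail, v ∉ L := by
      intro v hv hvL
      rcases mCBt v hv with rfl | e
      · rcases mL _ hvL with h' | h' <;> simp only [vx_fst] at h'
        · exact dBD h'.symm
        · exact dAD h'.symm
      · have hc := fst_of_mem_vseg e
        rcases mL _ hvL with h' | h' <;> rw [h'] at hc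
        · exact dBC hc
        · exact dAC hc
    exact ⟨routeData_of_paths SL hE hLRP hsplit RC hCBne hCBD hdisj, rfl, routeData_of_paths_b SL hE hLRP hsplit RC hCBne hCBD hdisj hCBeq⟩
  -- Route 2: by cases on `h₃ = h`
  have r₂ : ∃ r : (hexShadow k).RouteData RP D (vx k (toSite (XB m)) h) (vx k (toSite (XA m)) h) (vx k (toSite (XC m)) h₃),
      r.y = vx k (toSite (XD m)) h ∧ r.b = vx k (toSite (XB m)) h' := by
    by_cases h3 : h₃ = h
    · -- `h₃ = h`: `L' = (B,h)(D',h)(D',h')(C,h')(A,h')(A,h)`, `c :: Br' = (B,h)(B,h')(E,h')(F,h')(G,h')(H,h')(H,h)(C,h)`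
      subst h3
      have T1 : FPath k [vx k (toSite (XB m)) h₃, vx k (toSite (XD m)) h₃] (vx k (toSite (XB m)) h₃) (vx k (toSite (XD m)) h₃) :=
        FPath.pair (adj_vx_planar hDB.symm hh)
      have T2 : FPath k [vx k (toSite (XD m)) h₃, vx k (toSite (XD m)) h'] (vx k (toSite (XD m)) h₃) (vx k (toSite (XD m)) h') := FPath.pair vD
      have T3 : FPath k [vx k (toSite (XD m)) h', vx k (toSite (XC m)) h', vx k (toSite (XA m)) h'] (vx k (toSite (XD m)) h') (vx k (toSite (XA m)) h') :=
        fpath_three (adj_vx_planar hCD.symm hh'k) (adj_vx_planar hAC.symm hh'k) (fun e => dAD ((vx_inj hh'k hh'k).1 e).1.symm)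
      have T4 : FPath k [vx k (toSite (XA m)) h', vx k (toSite (XA m)) h₃] (vx k (toSite (XA m)) h') (vx k (toSite (XA m)) h₃) := FPath.pair vA
      have U1 : FPath k ([vx k (toSite (XB m)) h₃, vx k (toSite (XD m)) h₃] ++ [vx k (toSite (XD m)) h₃, vx k (toSite (XD m)) h'].tail)
          (vx k (toSite (XB m)) h₃) (vx k (toSite (XD m)) h') := by
        refine T1.trans T2 fun v hv hv1 => ?_
        simp only [List.mem_cons, List.not_mem_nil, or_false] at hv hv1
        rcases hv with rfl | rfl
        · rfl
        · rcases hv1 with e | e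
          · exact absurd ((vx_inj hh'k hh).1 e).1 dBD.symm
          · exact absurd ((vx_inj hh'k hh).1 e).2 hne'
      have U2 : FPath k (([vx k (toSite (XB m)) h₃, vx k (toSite (XD m)) h₃] ++ [vx k (toSite (XD m)) h₃, vx k (toSite (XD m)) h'].tail) ++
          [vx k (toSite (XD m)) h', vx k (toSite (XC m)) h', vx k (toSite (XA m)) h'].tail) (vx k (toSite (XB m)) h₃) (vx k (toSite (XA m)) h') := by
        refine U1.trans T3 fun v hv hv1 => ?_
        simp only [List.mem_cons, List.not_mem_nil, or_false, List.mem_append, List.tail_cons] at hv hv1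
        rcases hv with rfl | rfl | rfl
        · rfl
        · rcases hv1 with (e | e) | e
          · exact absurd ((vx_inj hh'k hh).1 e).2 hne'
          · exact absurd ((vx_inj hh'k hh).1 e).2 hne'
          · exact absurd ((vx_inj hh'k hh'k).1 e).1 dCD
        · rcases hv1 with (e | e) | e
          · exact absurd ((vx_inj hh'k hh).1 e).2 hne'
          · exact absurd ((vx_inj hh'k hh).1 e).2 hne'
          · exact absurd ((vx_inj hh'k hh'k).1 e).1 dAD
      have SL' : FPath k ((([vx k (toSite (XB m)) h₃, vx k (toSite (XD m)) h₃] ++ [vx k (toSite (XD m)) h₃, vx k (toSite (XD m)) h'].tail) ++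
          [vx k (toSite (XD m)) h', vx k (toSite (XC m)) h', vx k (toSite (XA m)) h'].tail) ++ [vx k (toSite (XA m)) h', vx k (toSite (XA m)) h₃].tail)
          (vx k (toSite (XB m)) h₃) (vx k (toSite (XA m)) h₃) := by
        refine U2.trans T4 fun v hv hv1 => ?_
        simp only [List.mem_cons, List.not_mem_nil, or_false, List.mem_append, List.tail_cons] at hv hv1
        rcases hv with rfl | rfl
        · rfl
        · rcases hv1 with ((e | e) | e) | e | e
          · exact absurd ((vx_inj hh hh).1 e).1 dAB
          · exact absurd ((vx_inj hh hh).1 e).1 dAD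
          · exact absurd ((vx_inj hh hh'k).1 e).2 hne'.symm
          · exact absurd ((vx_inj hh hh'k).1 e).2 hne'.symm
          · exact absurd ((vx_inj hh hh'k).1 e).2 hne'.symm
      have hL'eq : ((([vx k (toSite (XB m)) h₃, vx k (toSite (XD m)) h₃] ++ [vx k (toSite (XD m)) h₃, vx k (toSite (XD m)) h'].tail) ++
          [vx k (toSite (XD m)) h', vx k (toSite (XC m)) h', vx k (toSite (XA m)) h'].tail) ++ [vx k (toSite (XA m)) h', vx k (toSite (XA m)) h₃].tail) =
          [] ++ vx k (toSite (XB m)) h₃ :: vx k (toSite (XD m)) h₃ :: [vx k (toSite (XD m)) h', vx k (toSite (XC m)) h', vx k (toSite (XA m)) h', vx k (toSite (XA m)) h₃] := by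
        simp
      rw [hL'eq] at SL'
      -- the branch
      have W1 : FPath k [vx k (toSite (XB m)) h₃, vx k (toSite (XB m)) h'] (vx k (toSite (XB m)) h₃) (vx k (toSite (XB m)) h') := FPath.pair vB
      have W2 : FPath k (lay k h' ([XB m, XE m, XF m, XG m, XH m].map toSite)) (vx k (toSite (XB m)) h') (vx k (toSite (XH m)) h') :=
        fpath_lay_pts (by simp) (by cases m <;> decide) (by cases m <;> decide) hh'k
      have W3 : FPath k [vx k (toSite (XH m)) h', vx k (toSite (XH m)) h₃, vx k (toSite (XC m)) h₃] (vx k (toSite (XH m)) h') (vx k (toSite (XC m)) h₃) :=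
        fpath_three vH (adj_vx_planar hHC hh) (fun e => hne' ((vx_inj hh'k hh).1 e).2)
      have mW2 : ∀ v ∈ lay k h' ([XB m, XE m, XF m, XG m, XH m].map toSite), ∃ p ∈ [XB m, XE m, XF m, XG m, XH m], v = vx k (toSite p) h' := by
        intro v hv
        obtain ⟨q, hq, rfl⟩ := mem_lay.1 hv
        obtain ⟨p, hp, rfl⟩ := List.mem_map.1 hq
        exact ⟨p, hp, rfl⟩
      have V1 : FPath k ([vx k (toSite (XB m)) h₃, vx k (toSite (XB m)) h'] ++ (lay k h' ([XB m, XE m, XF m, XG m, XH m].map toSite)).tail)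
          (vx k (toSite (XB m)) h₃) (vx k (toSite (XH m)) h') := by
        refine W1.trans W2 fun v hv hv1 => ?_
        obtain ⟨p, hp, rfl⟩ := mW2 v hv
        simp only [List.mem_cons, List.not_mem_nil, or_false] at hv1
        rcases hv1 with e | e
        · exact absurd ((vx_inj hh'k hh).1 e).2 hne'
        · exact e
      have RC' : FPath k (([vx k (toSite (XB m)) h₃, vx k (toSite (XB m)) h'] ++ (lay k h' ([XB m, XE m, XF m, XG m, XH m].map toSite)).tail) ++
          [vx k (toSite (XH m)) h', vx k (toSite (XH m)) h₃, vx k (toSite (XC m)) h₃].tail) (vx k (toSite (XB m)) h₃) (vx k (toSite (XC m)) h₃) := by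
        refine V1.trans W3 fun v hv hv1 => ?_
        simp only [List.mem_cons, List.not_mem_nil, or_false] at hv
        rcases hv with rfl | rfl | rfl
        · rfl
        · exfalso
          rcases List.mem_append.1 hv1 with e | e
          · simp only [List.mem_cons, List.not_mem_nil, or_false] at e
            rcases e with e | e
            · exact dBH ((vx_inj hh hh).1 e).1.symm
            · exact hne' ((vx_inj hh hh'k).1 e).2.symm
          · obtain ⟨p, -, e⟩ := mW2 _ (List.mem_of_mem_tail e)
            exact hne' ((vx_inj hh hh'k).1 e).2.symm
        · exfalso
          rcases List.mem_append.1 hv1 with e | e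
          · simp only [List.mem_cons, List.not_mem_nil, or_false] at e
            rcases e with e | e
            · exact dBC ((vx_inj hh hh).1 e).1.symm
            · exact hne' ((vx_inj hh hh'k).1 e).2.symm
          · obtain ⟨p, -, e⟩ := mW2 _ (List.mem_of_mem_tail e)
            exact hne' ((vx_inj hh hh'k).1 e).2.symm
      have hCB'eq : (([vx k (toSite (XB m)) h₃, vx k (toSite (XB m)) h'] ++ (lay k h' ([XB m, XE m, XF m, XG m, XH m].map toSite)).tail) ++
          [vx k (toSite (XH m)) h', vx k (toSite (XH m)) h₃, vx k (toSite (XC m)) h₃].tail) =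
          vx k (toSite (XB m)) h₃ :: vx k (toSite (XB m)) h' :: (lay k h' ([XE m, XF m, XG m, XH m].map toSite) ++ [vx k (toSite (XH m)) h₃, vx k (toSite (XC m)) h₃]) := by
        simp [lay]
      rw [hCB'eq] at RC'
      have hsplit' : [] ++ vx k (toSite (XB m)) h₃ :: vx k (toSite (XD m)) h₃ :: [vx k (toSite (XD m)) h', vx k (toSite (XC m)) h', vx k (toSite (XA m)) h', vx k (toSite (XA m)) h₃]
          = [] ++ vx k (toSite (XB m)) h₃ :: vx k (toSite (XD m)) h₃ :: [vx k (toSite (XD m)) h', vx k (toSite (XC m)) h', vx k (toSite (XA m)) h', vx k (toSite (XA m)) h₃] := rfl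
      have hLRP' : ∀ v ∈ [] ++ vx k (toSite (XB m)) h₃ :: vx k (toSite (XD m)) h₃ :: [vx k (toSite (XD m)) h', vx k (toSite (XC m)) h', vx k (toSite (XA m)) h',
          vx k (toSite (XA m)) h₃], ((v : triFilm k) : Site 2 × Site 1).1 ∈ RP := by
        intro v hv
        simp only [List.nil_append, List.mem_cons, List.not_mem_nil, or_false] at hv
        rcases hv with rfl | rfl | rfl | rfl | rfl | rfl <;> simp only [vx_fst]
        exacts [X_RP hRP m hmemB, X_RP hRP m hmemD, X_RP hRP m hmemD, X_RP hRP m hmemC, X_RP hRP m hmemA, X_RP hRP m hmemA]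
      have hCBne : (vx k (toSite (XB m)) h₃ :: vx k (toSite (XB m)) h' :: (lay k h' ([XE m, XF m, XG m, XH m].map toSite) ++
          [vx k (toSite (XH m)) h₃, vx k (toSite (XC m)) h₃])).tail ≠ [] := by simp
      have hCBD : ∀ v ∈ (vx k (toSite (XB m)) h₃ :: vx k (toSite (XB m)) h' :: (lay k h' ([XE m, XF m, XG m, XH m].map toSite) ++
          [vx k (toSite (XH m)) h₃, vx k (toSite (XC m)) h₃])).tail, ((v : triFilm k) : Site 2 × Site 1).1 ∈ D := by
        intro v hv
        simp only [List.tail_cons, List.mem_cons, List.mem_append, List.not_mem_nil, or_false] at hv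
        rcases hv with rfl | hv | rfl | rfl
        · exact X_D hD m hmemB
        · obtain ⟨q, hq, rfl⟩ := mem_lay.1 hv
          obtain ⟨p, hp, rfl⟩ := List.mem_map.1 hq
          refine X_D hD m ?_
          simp only [List.mem_cons, List.not_mem_nil, or_false] at hp ⊢
          rcases hp with e | e | e | e <;> simp [e]
        · exact X_D hD m hmemH
        · exact X_D hD m hmemC
      have hdisj : ∀ v ∈ (vx k (toSite (XB m)) h₃ :: vx k (toSite (XB m)) h' :: (lay k h' ([XE m, XF m, XG m, XH m].map toSite) ++
          [vx k (toSite (XH m)) h₃, vx k (toSite (XC m)) h₃])).tail,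
          v ∉ [] ++ vx k (toSite (XB m)) h₃ :: vx k (toSite (XD m)) h₃ :: [vx k (toSite (XD m)) h', vx k (toSite (XC m)) h', vx k (toSite (XA m)) h', vx k (toSite (XA m)) h₃] := by
        intro v hv hvL
        simp only [List.nil_append, List.mem_cons, List.not_mem_nil, or_false] at hvL
        simp only [List.tail_cons, List.mem_cons, List.mem_append, List.not_mem_nil, or_false] at hv
        -- `v` is `(B,h')`, a layer-`h'` vertex over `E,F,G,H`, `(H,h)` or `(C,h)`; the layer-`h'` vertices of `L'` are over `D', C, A`, its layer-`h` ones over `B, D', A`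
        rcases hv with rfl | hv | rfl | rfl
        · rcases hvL with e | e | e | e | e | e
          · exact hne' ((vx_inj hh'k hh).1 e).2
          · exact hne' ((vx_inj hh'k hh).1 e).2
          · exact dBD ((vx_inj hh'k hh'k).1 e).1
          · exact dBC ((vx_inj hh'k hh'k).1 e).1
          · exact dAB ((vx_inj hh'k hh'k).1 e).1.symm
          · exact hne' ((vx_inj hh'k hh).1 e).2
        · obtain ⟨q, hq, rfl⟩ := mem_lay.1 hv
          obtain ⟨p, hp, rfl⟩ := List.mem_map.1 hq
          rcases hvL with e | e | e | e | e | e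
          · exact hne' ((vx_inj hh'k hh).1 e).2
          · exact hne' ((vx_inj hh'k hh).1 e).2
          · have := toSite_injective ((vx_inj hh'k hh'k).1 e).1; rw [this] at hp; revert hp; cases m <;> decide
          · have := toSite_injective ((vx_inj hh'k hh'k).1 e).1; rw [this] at hp; revert hp; cases m <;> decide
          · have := toSite_injective ((vx_inj hh'k hh'k).1 e).1; rw [this] at hp; revert hp; cases m <;> decide
          · exact hne' ((vx_inj hh'k hh).1 e).2
        · rcases hvL with e | e | e | e | e | e
          · exact dBH ((vx_inj hh hh).1 e).1.symm
          · exact dDH ((vx_inj hh hh).1 e).1.symm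
          · exact hne' ((vx_inj hh hh'k).1 e).2.symm
          · exact hne' ((vx_inj hh hh'k).1 e).2.symm
          · exact hne' ((vx_inj hh hh'k).1 e).2.symm
          · exact dAH ((vx_inj hh hh).1 e).1.symm
        · rcases hvL with e | e | e | e | e | e
          · exact dBC ((vx_inj hh hh).1 e).1.symm
          · exact dCD ((vx_inj hh hh).1 e).1
          · exact hne' ((vx_inj hh hh'k).1 e).2.symm
          · exact hne' ((vx_inj hh hh'k).1 e).2.symm
          · exact hne' ((vx_inj hh hh'k).1 e).2.symm
          · exact dAC ((vx_inj hh hh).1 e).1.symm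
      exact ⟨routeData_of_paths SL' hE hLRP' hsplit' RC' hCBne hCBD hdisj, rfl, routeData_of_paths_b SL' hE hLRP' hsplit' RC' hCBne hCBD hdisj rfl⟩
    · -- `h₃ ≠ h`: `L' = (B,h)(D',h)(C,h)(A,h)`, `c :: Br' = (B,h)(B,h')(C,h') · column C`
      have SL' : FPath k [vx k (toSite (XB m)) h, vx k (toSite (XD m)) h, vx k (toSite (XC m)) h, vx k (toSite (XA m)) h] (vx k (toSite (XB m)) h)
          (vx k (toSite (XA m)) h) :=
        fpath_four (adj_vx_planar hDB.symm hh) (adj_vx_planar hCD.symm hh) (adj_vx_planar hAC.symm hh) (fun e => dBC ((vx_inj hh hh).1 e).1) hE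
          (fun e => dAD ((vx_inj hh hh).1 e).1.symm)
      have W1 : FPath k [vx k (toSite (XB m)) h, vx k (toSite (XB m)) h', vx k (toSite (XC m)) h'] (vx k (toSite (XB m)) h) (vx k (toSite (XC m)) h') :=
        fpath_three vB (adj_vx_planar hBC hh'k) (fun e => dBC ((vx_inj hh hh'k).1 e).1)
      have W2 : FPath k (vseg k (toSite (XC m)) h' h₃) (vx k (toSite (XC m)) h') (vx k (toSite (XC m)) h₃) := fpath_vseg _ hh'k hh₃
      have RC' : FPath k ([vx k (toSite (XB m)) h, vx k (toSite (XB m)) h', vx k (toSite (XC m)) h'] ++ (vseg k (toSite (XC m)) h' h₃).tail)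
          (vx k (toSite (XB m)) h) (vx k (toSite (XC m)) h₃) := by
        refine W1.trans W2 fun v hv hv1 => ?_
        simp only [List.mem_cons, List.not_mem_nil, or_false] at hv1
        rcases hv1 with rfl | rfl | rfl
        · exact absurd (fst_of_mem_vseg hv) dBC
        · exact absurd (fst_of_mem_vseg hv) dBC
        · rfl
      have hsplit' : [vx k (toSite (XB m)) h, vx k (toSite (XD m)) h, vx k (toSite (XC m)) h, vx k (toSite (XA m)) h] =
          [] ++ vx k (toSite (XB m)) h :: vx k (toSite (XD m)) h :: [vx k (toSite (XC m)) h, vx k (toSite (XA m)) h] := rfl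
      have hCBeq' : [vx k (toSite (XB m)) h, vx k (toSite (XB m)) h', vx k (toSite (XC m)) h'] ++ (vseg k (toSite (XC m)) h' h₃).tail =
          vx k (toSite (XB m)) h :: vx k (toSite (XB m)) h' :: (vx k (toSite (XC m)) h' :: (vseg k (toSite (XC m)) h' h₃).tail) := by simp
      have hLRP' : ∀ v ∈ [vx k (toSite (XB m)) h, vx k (toSite (XD m)) h, vx k (toSite (XC m)) h, vx k (toSite (XA m)) h],
          ((v : triFilm k) : Site 2 × Site 1).1 ∈ RP := by
        intro v hv
        simp only [List.mem_cons, List.not_mem_nil, or_false] at hv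
        rcases hv with rfl | rfl | rfl | rfl <;> simp only [vx_fst]
        exacts [X_RP hRP m hmemB, X_RP hRP m hmemD, X_RP hRP m hmemC, X_RP hRP m hmemA]
      have mCBt : ∀ v ∈ ([vx k (toSite (XB m)) h, vx k (toSite (XB m)) h', vx k (toSite (XC m)) h'] ++ (vseg k (toSite (XC m)) h' h₃).tail).tail,
          v = vx k (toSite (XB m)) h' ∨ v ∈ vseg k (toSite (XC m)) h' h₃ := by
        intro v hv
        simp only [List.cons_append, List.tail_cons, List.mem_cons] at hv
        rcases hv with rfl | rfl | hv
        · exact Or.inl rfl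
        · exact Or.inr W2.head_mem
        · exact Or.inr (List.mem_of_mem_tail hv)
      have hCBne : ([vx k (toSite (XB m)) h, vx k (toSite (XB m)) h', vx k (toSite (XC m)) h'] ++ (vseg k (toSite (XC m)) h' h₃).tail).tail ≠ [] := by simp
      have hCBD : ∀ v ∈ ([vx k (toSite (XB m)) h, vx k (toSite (XB m)) h', vx k (toSite (XC m)) h'] ++ (vseg k (toSite (XC m)) h' h₃).tail).tail,
          ((v : triFilm k) : Site 2 × Site 1).1 ∈ D := by
        intro v hv; rcases mCBt v hv with e | e
        · rw [e]; exact X_D hD m hmemB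
        · rw [fst_of_mem_vseg e]; exact X_D hD m hmemC
      have hdisj : ∀ v ∈ ([vx k (toSite (XB m)) h, vx k (toSite (XB m)) h', vx k (toSite (XC m)) h'] ++ (vseg k (toSite (XC m)) h' h₃).tail).tail,
          v ∉ [vx k (toSite (XB m)) h, vx k (toSite (XD m)) h, vx k (toSite (XC m)) h, vx k (toSite (XA m)) h] := by
        intro v hv hvL
        simp only [List.mem_cons, List.not_mem_nil, or_false] at hvL
        rcases mCBt v hv with rfl | e
        · rcases hvL with e | e | e | e
          · exact hne' ((vx_inj hh'k hh).1 e).2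
          · exact hne' ((vx_inj hh'k hh).1 e).2
          · exact hne' ((vx_inj hh'k hh).1 e).2
          · exact hne' ((vx_inj hh'k hh).1 e).2
        · obtain ⟨i, hi1, hi2, rfl⟩ := mem_vseg.1 e
          have hik : i ≤ k := le_trans hi2 (max_le hh'k hh₃)
          have hi : i ≠ h := fun e => (hfar h3) ⟨e ▸ hi1, e ▸ hi2⟩
          rcases hvL with e | e | e | e
          · exact hi ((vx_inj hik hh).1 e).2
          · exact hi ((vx_inj hik hh).1 e).2
          · exact hi ((vx_inj hik hh).1 e).2
          · exact hi ((vx_inj hik hh).1 e).2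
      exact ⟨routeData_of_paths SL' hE hLRP' hsplit' RC' hCBne hCBD hdisj, rfl, routeData_of_paths_b SL' hE hLRP' hsplit' RC' hCBne hCBD hdisj hCBeq'⟩
  obtain ⟨r₁, hy₁, hb₁⟩ := r₁
  obtain ⟨r₂, hy₂, hb₂⟩ := r₂
  exact ⟨r₁, r₂, by rw [hy₁, hb₂], by rw [hb₁, hy₂]⟩

/-- **THE SIXTEEN EXCEPTIONAL CONFIGURATIONS** (`tR = 0`, blocked corners): swap pairs for all heights, `k ≥ 2`.
[cite: DuminilCopinSidoraviciusTassion2016, §2.3 (proof of Fact 2)] -/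
theorem exists_swap_pair_exceptional {a1 a2 a3 : Pt} (hx : exceptional 0 a1 a2 a3 = true) {h₁ h₂ h₃ : ℕ} (hh₁ : h₁ ≤ k) (hh₂ : h₂ ≤ k) (hh₃ : h₃ ≤ k)
    (hE : vx k (toSite a1) h₁ ≠ vx k (toSite a2) h₂) :
    ∃ r₁ r₂ : (hexShadow k).RouteData RP D (vx k (toSite a1) h₁) (vx k (toSite a2) h₂) (vx k (toSite a3) h₃), r₁.y = r₂.b ∧ r₁.b = r₂.y := by
  simp only [exceptional, Bool.and_eq_true, Bool.or_eq_true, beq_iff_eq, Prod.mk.injEq, true_and] at hx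
  rcases hx with ⟨(⟨rfl, rfl⟩ | ⟨rfl, rfl⟩), rfl⟩ | ⟨(⟨rfl, rfl⟩ | ⟨rfl, rfl⟩), rfl⟩
  · exact exists_swap_pair_X1 hk hRP hD false hh₁ hh₂ hh₃ hE
  · by_cases h12 : h₁ = h₂
    · subst h12; exact exists_swap_pair_X2_eq hk hRP hD false hh₁ hh₃
    · exact exists_swap_pair_X2_ne hRP hD false hh₁ hh₂ hh₃ h12
  · exact exists_swap_pair_X1 hk hRP hD true hh₁ hh₂ hh₃ hE
  · by_cases h12 : h₁ = h₂
    · subst h12; exact exists_swap_pair_X2_eq hk hRP hD true hh₁ hh₃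
    · exact exists_swap_pair_X2_ne hRP hD true hh₁ hh₂ hh₃ h12

end Routes

end TriFilm

end Summit.CriticalPhenomena.PercolationContinuityZ3.Theorems.Transplant

end
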